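import Summits.ValiantsHypothesis.ValiantsHypothesis.Theorems.KPlusLogSqLawTropicalBToeplitzConjectureT

/-!
# Route `KPlusLogSqLaw`, crux `TropicalB` — Toeplitz sector: the FOOTRULE MAXIMUM and its equality case (the forcing device of the doubling law)

HONEST FRAMING.  Helper toward the registered stubs `stub_tropThin` / `stub_tropFat` of `Cruxes/TropicalB/Lines/birth.lean` (crux
`Summit.ValiantsHypothesis.ValiantsHypothesis.Theses.KPlusLogSqLaw.TropicalB`, ledger item `stmt-ValiantsHypothesis-19771`, route `KPlusLogSqLaw`; cell
`pub-symmetroid`, seat `val-sym-trop-p4` (g22), 2026-08-29).  First ingredient of this seat's BIPARTITE DOUBLING LAW for the Toeplitz-sector chains of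
the cell's Conjecture T / Q (memo HOME/val-sym-trop-p4/g22/DOUBLING-g22.md §1; located consequence §2: `Φ_Q(8,16,32,64) ≥ 19, 57, 185, 650`, kernel row
`…ToeplitzThirtyTwo166`): in a doubled instance of size `n + n` a footrule reward `C·|τ b − b|` is added to the intercepts, and the two facts below say
exactly which permutations collect the maximal reward — the BIPARTITE ones (`τ` maps the lower half onto the upper half), on which the doubled weight
splits as `W¹(π) + W²(ρ) + 2Cn²`.  Nothing here bounds `Φ_Toep`; nothing bears on `TropicalB` for general designs, `KPlusLogSqLaw`, `MatrixDescartes` or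
`VP ≠ VNP`.

* `two_mul_abs_sub_le` — `2|x − y| ≤ |2x − c| + |2y − c|`, with equality iff `2x − c` and `2y − c` do not have the same strict sign;
* `sum_abs_two_mul_sub_pred` — `Σ_{b < n+n} |2b − (2n − 1)| = 2n²`;
* `footrule_le` — **Spearman's footrule of a permutation of `Fin (n+n)` is at most `2n²`**: `Σ_b |τ b − b| ≤ 2n²` [Diaconis–Graham 1977, the
  maximum of the footrule; folklore proof via the centre `n − ½`];
* `lt_iff_le_of_footrule_eq` — **equality forces bipartiteness**: if `Σ_b |τ b − b| = 2n²` then `b < n ↔ n ≤ τ b` for every `b`;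
* `footrule_eq_of_bipartite` — and conversely.

References: P. Diaconis, R. L. Graham, *Spearman's footrule as a measure of disarray*, J. Roy. Statist. Soc. B 39 (1977) 262–268 (the bound
`max D = ⌊m²/2⌋`); folklore (triangle inequality through the centre).
-/

set_option linter.dupNamespace false
set_option autoImplicit false

namespace Summit.ValiantsHypothesis.ValiantsHypothesis.Theorems.KPlusLogSqLaw.Toeplitz

open scoped BigOperators
open Finset

section Footrule

/-- `2|x − y| ≤ |2x − c| + |2y − c|` (triangle inequality through `c/2`). [folklore] -/
theorem two_mul_abs_sub_le (x y c : ℤ) : 2 * |x - y| ≤ |2 * x - c| + |2 * y - c| := by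
  have h : 2 * (x - y) = (2 * x - c) - (2 * y - c) := by ring
  rw [show (2 : ℤ) * |x - y| = |2 * (x - y)| by rw [abs_mul]; norm_num, h]
  exact abs_sub _ _

/-- Equality in `two_mul_abs_sub_le` forces `2x − c` and `2y − c` NOT to be both positive or both negative. [folklore] -/
theorem not_same_side_of_two_mul_abs_sub_eq (x y c : ℤ) (h : 2 * |x - y| = |2 * x - c| + |2 * y - c|) :
    ¬ (0 < 2 * x - c ∧ 0 < 2 * y - c) ∧ ¬ (2 * x - c < 0 ∧ 2 * y - c < 0) := by
  constructor
  · rintro ⟨hx, hy⟩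
    rw [abs_of_pos hx, abs_of_pos hy] at h
    rcases le_or_gt y x with hxy | hxy
    · rw [abs_of_nonneg (by linarith)] at h; linarith
    · rw [abs_of_neg (by linarith)] at h; linarith
  · rintro ⟨hx, hy⟩
    rw [abs_of_neg hx, abs_of_neg hy] at h
    rcases le_or_gt y x with hxy | hxy
    · rw [abs_of_nonneg (by linarith)] at h; linarith
    · rw [abs_of_neg (by linarith)] at h; linarith

/-- `Σ_{i < n} (2i + 1) = n²`. [folklore] -/
theorem sum_range_two_mul_add_one (n : ℕ) : ∑ i ∈ range n, (2 * (i : ℤ) + 1) = (n : ℤ) ^ 2 := by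
  induction n with
  | zero => simp
  | succ k ih => rw [sum_range_succ, ih]; push_cast; ring

/-- `Σ_{b < n+n} |2b − (2n − 1)| = 2n²` (the total distance of the positions to the centre, doubled). [folklore] -/
theorem sum_abs_two_mul_sub_pred (n : ℕ) :
    ∑ b : Fin (n + n), |2 * (b : ℤ) - (2 * n - 1)| = 2 * (n : ℤ) ^ 2 := by
  rw [Fin.sum_univ_add]
  have h1 : ∑ b : Fin n, |2 * ((Fin.castAdd n b : Fin (n + n)) : ℤ) - (2 * n - 1)| = ∑ i ∈ range n, (2 * (i : ℤ) + 1) := by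
    rw [← Fin.sum_univ_eq_sum_range (fun i => (2 * (i : ℤ) + 1)) n,
      ← Equiv.sum_comp Fin.revPerm (fun b : Fin n => |2 * ((Fin.castAdd n b : Fin (n + n)) : ℤ) - (2 * n - 1)|)]
    refine sum_congr rfl fun b _ => ?_
    have hb := b.isLt
    simp only [Fin.revPerm_apply, Fin.val_castAdd, Fin.val_rev]
    rw [Nat.cast_sub (by omega), abs_of_nonpos (by push_cast; omega)]
    push_cast
    ring
  have h2 : ∑ b : Fin n, |2 * ((Fin.natAdd n b : Fin (n + n)) : ℤ) - (2 * n - 1)| = ∑ i ∈ range n, (2 * (i : ℤ) + 1) := by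
    rw [← Fin.sum_univ_eq_sum_range (fun i => (2 * (i : ℤ) + 1)) n]
    refine sum_congr rfl fun b _ => ?_
    simp only [Fin.val_natAdd]
    push_cast
    rw [abs_of_nonneg (by omega)]
    ring
  rw [h1, h2, sum_range_two_mul_add_one]; ring

/-- **The footrule maximum** [Diaconis–Graham 1977]: for every permutation `τ` of `Fin (n + n)`, `Σ_b |τ b − b| ≤ 2n²`. -/
theorem footrule_le {n : ℕ} (τ : Equiv.Perm (Fin (n + n))) :
    ∑ b : Fin (n + n), |((τ b : Fin (n + n)) : ℤ) - (b : ℤ)| ≤ 2 * (n : ℤ) ^ 2 := by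
  have key : 2 * ∑ b : Fin (n + n), |((τ b : Fin (n + n)) : ℤ) - (b : ℤ)| ≤
      ∑ b : Fin (n + n), (|2 * ((τ b : Fin (n + n)) : ℤ) - (2 * n - 1)| + |2 * (b : ℤ) - (2 * n - 1)|) := by
    rw [mul_sum]
    exact sum_le_sum fun b _ => two_mul_abs_sub_le _ _ _
  rw [sum_add_distrib, Equiv.sum_comp τ (fun a : Fin (n + n) => |2 * (a : ℤ) - (2 * n - 1)|),
    sum_abs_two_mul_sub_pred] at key
  linarith

/-- **Equality in the footrule bound forces BIPARTITENESS**: if `Σ_b |τ b − b| = 2n²` then every lower position goes up and every upper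
position goes down: `b < n ↔ n ≤ τ b`. [folklore] -/
theorem lt_iff_le_of_footrule_eq {n : ℕ} (τ : Equiv.Perm (Fin (n + n)))
    (h : ∑ b : Fin (n + n), |((τ b : Fin (n + n)) : ℤ) - (b : ℤ)| = 2 * (n : ℤ) ^ 2) (b : Fin (n + n)) :
    (b : ℕ) < n ↔ n ≤ ((τ b : Fin (n + n)) : ℕ) := by
  -- every term of the pointwise inequality is an equality
  have hle : ∀ a ∈ (univ : Finset (Fin (n + n))), 2 * |((τ a : Fin (n + n)) : ℤ) - (a : ℤ)| ≤
      |2 * ((τ a : Fin (n + n)) : ℤ) - (2 * n - 1)| + |2 * (a : ℤ) - (2 * n - 1)| :=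
    fun a _ => two_mul_abs_sub_le _ _ _
  have hsum : ∑ a : Fin (n + n), 2 * |((τ a : Fin (n + n)) : ℤ) - (a : ℤ)| =
      ∑ a : Fin (n + n), (|2 * ((τ a : Fin (n + n)) : ℤ) - (2 * n - 1)| + |2 * (a : ℤ) - (2 * n - 1)|) := by
    rw [← mul_sum, h, sum_add_distrib, Equiv.sum_comp τ (fun a : Fin (n + n) => |2 * (a : ℤ) - (2 * n - 1)|),
      sum_abs_two_mul_sub_pred]; ring
  have heq := (sum_eq_sum_iff_of_le hle).mp hsum b (mem_univ b)
  obtain ⟨h1, h2⟩ := not_same_side_of_two_mul_abs_sub_eq _ _ _ heq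
  have hb := b.isLt
  have hτ := (τ b).isLt
  constructor
  · intro hbn
    by_contra hcon
    push Not at hcon
    exact h2 ⟨by omega, by omega⟩
  · intro hτn
    by_contra hcon
    push Not at hcon
    exact h1 ⟨by omega, by omega⟩

/-- **Conversely, bipartite permutations attain the footrule maximum**: if `b < n ↔ n ≤ τ b` for all `b` then `Σ_b |τ b − b| = 2n²`. [folklore] -/
theorem footrule_eq_of_bipartite {n : ℕ} (τ : Equiv.Perm (Fin (n + n)))
    (hbip : ∀ b : Fin (n + n), (b : ℕ) < n ↔ n ≤ ((τ b : Fin (n + n)) : ℕ)) :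
    ∑ b : Fin (n + n), |((τ b : Fin (n + n)) : ℤ) - (b : ℤ)| = 2 * (n : ℤ) ^ 2 := by
  have hpt : ∀ b : Fin (n + n), 2 * |((τ b : Fin (n + n)) : ℤ) - (b : ℤ)| =
      |2 * ((τ b : Fin (n + n)) : ℤ) - (2 * n - 1)| + |2 * (b : ℤ) - (2 * n - 1)| := by
    intro b
    have hb := b.isLt
    have hτ := (τ b).isLt
    by_cases hbn : (b : ℕ) < n
    · have hτn : n ≤ ((τ b : Fin (n + n)) : ℕ) := (hbip b).mp hbn
      rw [abs_of_nonneg (by omega), abs_of_nonneg (by omega), abs_of_nonpos (by omega)]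
      ring
    · have hτn : ((τ b : Fin (n + n)) : ℕ) < n := by
        by_contra hc; push Not at hc; exact hbn ((hbip b).mpr hc)
      rw [abs_of_nonpos (by omega), abs_of_nonpos (by omega), abs_of_nonneg (by omega)]
      ring
  have hsum : 2 * ∑ b : Fin (n + n), |((τ b : Fin (n + n)) : ℤ) - (b : ℤ)| = 2 * (2 * (n : ℤ) ^ 2) := by
    rw [mul_sum, sum_congr rfl fun b _ => hpt b, sum_add_distrib,
      Equiv.sum_comp τ (fun a : Fin (n + n) => |2 * (a : ℤ) - (2 * n - 1)|), sum_abs_two_mul_sub_pred]; ring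
  linarith

end Footrule

end Summit.ValiantsHypothesis.ValiantsHypothesis.Theorems.KPlusLogSqLaw.Toeplitz
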